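import Summits.QuantumFields.BalabanUV.Beta.EriceRemainderEnclosureHistoryAutonomyComparisonTwoAgesMarkov

/-!
# EriceRemainderEnclosureHistoryAutonomyComparisonThreeAgesReads — THE READS OF THREE AGES `1 ≤ k₁ ≤ k₂ ≤ k₃ ≤ 36·k₁` AND THE CLEARED THREE-AGE CUBIC:
# the algebra behind «three ages with outer ratio ≤ 36 pass (E58b)'s profile condition» (sequel (P3·T1b) `…ComparisonThreeAgesNear` assembles the END)

Cell `pub-balaban`, β-function sub-cell, BINDER row D4 «RemainderConst leaves for Bałaban's split» (`HOME/BINDER-OWNERS.md`; owner lineage `b2b-balaban-beta-an4`);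
this file by co-owner #3 lineage `b2b-balaban-beta-d4-p3` (generation 100), towards sub-problem (P1) of co-owner #2's strategy note
`HOME/b2b-balaban-beta-d4-p2/g56/STRATEGY-E58prime.md` §5 at its target ratio `R₀ = 36` («three ages at intermediate ratios», NOT CLAIMED in (E63d)).
β-FLOW TEAM duty (1), FREEZE (0) honoured (def-free; Mathlib's `Real.le_sqrt_of_sq_le` ∕ `div_le_div_iff₀` BY NAME; nothing of (E58b)∕(E63d) restated).

HONEST FRAMING (page 1, verbatim and binding).  *"Discharging BetaPertH makes Bałaban's UV stability UNCONDITIONAL — a real constructive-QFT result; it is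
NOT the continuum limit and NOT the Clay problem."*  THIS FILE DISCHARGES NOTHING OF THE KIND.  Elementary real algebra about square roots of ratios of
three natural numbers and one cubic form — hypotheses of a census, not facts; the form, signs, ages and moments of Bałaban's (1.22) limit functional are NOT
PRINTED ([I] p. 298; GAPS G-t4-U2-1∕-2) and NOT asserted.  Row D4 class UNCHANGED (critical-path width 0; instance 0∕1; D4 DISCHARGE NO DATE).
HONEST DEPENDENCY: continuum YM on T⁴ ⇐ BetaPertH ∧ nine spine estimates (0/9 proved); BetaPertH ⇐ (D1) ∧ (D4) ∧ CAP+tail; G-an2-4 gates asym, D1 and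
NE2/3/4.

THE POINT (census sense (α); the COMPARISON column, conjecture (E58′)).  Three ages `k₁ < k₂ < k₃` carry six off-diagonal reads `p = √(k₁∕(k₁+k₂))`,
`p′ = √(k₂∕(k₂+k₁))`, `q = √(k₁∕(k₁+k₃))`, `q′ = √(k₃∕(k₃+k₁))`, `r = √(k₂∕(k₂+k₃))`, `r′ = √(k₃∕(k₃+k₂))` and the diagonal read `ρ = √½`.  With the weights
`x, y, z ≥ 0` of the three ages and `D_a = ρx+py+qz`, `D_b = p′x+ρy+rz`, `D_c = q′x+r′y+ρz`, the profile condition `x∕D_a + y∕D_b + z∕D_c ≤ 2` is the CUBIC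
inequality `x·D_bD_c + y·D_aD_c + z·D_aD_b ≤ 2·D_aD_bD_c`.  §1 (`three_age_form_le`, `three_age_sum_div_le_two`): the difference is a cubic form with TEN
displayed monomial coefficients — `κ := 2ρ − 1`: `x³ κp′q′`, `y³ κpr′`, `z³ κqr`, `x²y κp′r′ + q′(2pp′−κ)`, `x²z κrq′ + p′(2qq′−κ)`, `xy² κpq′ + r′(2pp′−κ)`,
`xz² κqp′ + r(2qq′−κ)`, `y²z κqr′ + p(2rr′−κ)`, `yz² κpr + q(2rr′−κ)`, `xyz κ(½ + pp′ + qq′ + rr′) + 2(prq′ + qp′r′) − 1` (an identity modulo `ρ² = ½`), so the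
inequality holds once the ten are `≥ 0`.  §2: the relations between the reads that make them so for `k₃ ≤ 36k₁` (numerically the ten stay `≥ 0` exactly up to
`k₃∕k₁ ≈ 40`; at `36` the least is `≈ 0.0036`, at `k₁ = k₂` or `k₂ = k₃`): `r ≥ 2ρ·q·p′` ⇐ `(k₂−k₁)(k₃−k₁) ≥ 0`; `p′ ≥ 2ρ·q′·r` ⇐ `(k₃−k₁)(k₃−k₂) ≥ 0`;
`pr ≥ ρq` and `p′r′ ≥ ρq′` ⇐ `(k₂−k₁)(k₃−k₂) ≥ 0`; `qr′ ≥ 0.2293·p` and `pq′ ≥ 0.2293·r′` ⇐ the ratio `36` (`0.2293² < 72∕1369`); and the one genuine lemma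
**`pp′ + rr′ − qq′ ≥ ½`** (`pairSum_ge_half`: with `α = √k₁, β = √k₂, δ = √k₃` the cleared difference is `½(β−α)(δ−β)·K`, `K = δ²(β−α)(6α−δ) + δ²((β−5α∕2)²
+ 7α²∕4) + 2αβ²δ + α²βδ + α²β² + α³(δ−β) ≥ 0` for `δ ≤ 6α`; `K < 0` from `δ ≈ 9α`: the lemma fails from outer ratio `≈ 70`).  NOT CLAIMED: anything printed.

WHAT IS PROVED ([folklore]; 0 `def`, 0 sorry).  §1 **`three_age_form_le`**, `three_age_sum_div_le_two`, `pos_of_coeff_ge`, `sqrt_half_bounds`.  §2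
`sqrt_pair_mul`, `read23_ge`, `read21_ge`, `read12_mul_read23_ge`, `read21_mul_read32_ge`, `read13_mul_read32_ge`, `read12_mul_read31_ge`,
`diag_le_read_of_le`, `pairSum_ge_half_aux`, **`pairSum_ge_half`**.
-/
noncomputable section
open Finset Set

namespace Summit.QuantumFields.BalabanUV.Beta.EriceRemainderEnclosureHistoryAutonomyComparisonThreeAgesReads

variable {k₁ k₂ k₃ : ℕ}

/-! ## §1 The cleared three-age form: a cubic whose ten monomial coefficients are displayed -/

/-- **THE CUBIC OF THREE AGES.**  For reads `ρ` (diagonal, `ρ² = ½`), `p, p′, q, q′, r, r′` and weights `x, y, z ≥ 0`, with `D_a = ρx+py+qz`, `D_b = p′x+ρy+rz`,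
`D_c = q′x+r′y+ρz`: `2·D_aD_bD_c − (x·D_bD_c + y·D_aD_c + z·D_aD_b)` is the cubic form with the ten displayed coefficients (identity modulo `ρ² = ½`), hence
`x·D_bD_c + y·D_aD_c + z·D_aD_b ≤ 2·D_aD_bD_c` once the ten coefficients are non-negative. [folklore] -/
theorem three_age_form_le {ρ p p' q q' r r' x y z : ℝ} (hρ : ρ * ρ = 1 / 2) (hx : 0 ≤ x) (hy : 0 ≤ y) (hz : 0 ≤ z)
    (c1 : 0 ≤ (2 * ρ - 1) * p' * q') (c2 : 0 ≤ (2 * ρ - 1) * p * r') (c3 : 0 ≤ (2 * ρ - 1) * q * r)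
    (c4 : 0 ≤ (2 * ρ - 1) * p' * r' + q' * (2 * p * p' - (2 * ρ - 1)))
    (c5 : 0 ≤ (2 * ρ - 1) * r * q' + p' * (2 * q * q' - (2 * ρ - 1)))
    (c6 : 0 ≤ (2 * ρ - 1) * p * q' + r' * (2 * p * p' - (2 * ρ - 1)))
    (c7 : 0 ≤ (2 * ρ - 1) * q * p' + r * (2 * q * q' - (2 * ρ - 1)))
    (c8 : 0 ≤ (2 * ρ - 1) * q * r' + p * (2 * r * r' - (2 * ρ - 1)))
    (c9 : 0 ≤ (2 * ρ - 1) * p * r + q * (2 * r * r' - (2 * ρ - 1)))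
    (c10 : 0 ≤ (2 * ρ - 1) * (1 / 2 + p * p' + q * q' + r * r') + 2 * (p * r * q' + q * p' * r') - 1) :
    x * ((p' * x + ρ * y + r * z) * (q' * x + r' * y + ρ * z)) + y * ((ρ * x + p * y + q * z) * (q' * x + r' * y + ρ * z))
        + z * ((ρ * x + p * y + q * z) * (p' * x + ρ * y + r * z))
      ≤ 2 * ((ρ * x + p * y + q * z) * (p' * x + ρ * y + r * z) * (q' * x + r' * y + ρ * z)) := by
  have key : 2 * ((ρ * x + p * y + q * z) * (p' * x + ρ * y + r * z) * (q' * x + r' * y + ρ * z))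
      - (x * ((p' * x + ρ * y + r * z) * (q' * x + r' * y + ρ * z)) + y * ((ρ * x + p * y + q * z) * (q' * x + r' * y + ρ * z))
        + z * ((ρ * x + p * y + q * z) * (p' * x + ρ * y + r * z)))
      = (2 * ρ - 1) * p' * q' * x ^ 3 + (2 * ρ - 1) * p * r' * y ^ 3 + (2 * ρ - 1) * q * r * z ^ 3
        + ((2 * ρ - 1) * p' * r' + q' * (2 * p * p' - (2 * ρ - 1))) * (x ^ 2 * y)
        + ((2 * ρ - 1) * r * q' + p' * (2 * q * q' - (2 * ρ - 1))) * (x ^ 2 * z)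
        + ((2 * ρ - 1) * p * q' + r' * (2 * p * p' - (2 * ρ - 1))) * (x * y ^ 2)
        + ((2 * ρ - 1) * q * p' + r * (2 * q * q' - (2 * ρ - 1))) * (x * z ^ 2)
        + ((2 * ρ - 1) * q * r' + p * (2 * r * r' - (2 * ρ - 1))) * (y ^ 2 * z)
        + ((2 * ρ - 1) * p * r + q * (2 * r * r' - (2 * ρ - 1))) * (y * z ^ 2)
        + ((2 * ρ - 1) * (1 / 2 + p * p' + q * q' + r * r') + 2 * (p * r * q' + q * p' * r') - 1) * (x * y * z) := by
    linear_combination (2 * q' * x ^ 2 * y + 2 * p' * x ^ 2 * z + 2 * r' * x * y ^ 2 + 2 * r * x * z ^ 2 + 2 * p * y ^ 2 * z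
      + 2 * q * y * z ^ 2 + (2 * ρ - 3) * x * y * z) * hρ
  rw [← sub_nonneg, key]
  have m1 : 0 ≤ (2 * ρ - 1) * p' * q' * x ^ 3 := mul_nonneg c1 (pow_nonneg hx 3)
  have m2 : 0 ≤ (2 * ρ - 1) * p * r' * y ^ 3 := mul_nonneg c2 (pow_nonneg hy 3)
  have m3 : 0 ≤ (2 * ρ - 1) * q * r * z ^ 3 := mul_nonneg c3 (pow_nonneg hz 3)
  have m4 : 0 ≤ ((2 * ρ - 1) * p' * r' + q' * (2 * p * p' - (2 * ρ - 1))) * (x ^ 2 * y) := mul_nonneg c4 (by positivity)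
  have m5 : 0 ≤ ((2 * ρ - 1) * r * q' + p' * (2 * q * q' - (2 * ρ - 1))) * (x ^ 2 * z) := mul_nonneg c5 (by positivity)
  have m6 : 0 ≤ ((2 * ρ - 1) * p * q' + r' * (2 * p * p' - (2 * ρ - 1))) * (x * y ^ 2) := mul_nonneg c6 (by positivity)
  have m7 : 0 ≤ ((2 * ρ - 1) * q * p' + r * (2 * q * q' - (2 * ρ - 1))) * (x * z ^ 2) := mul_nonneg c7 (by positivity)
  have m8 : 0 ≤ ((2 * ρ - 1) * q * r' + p * (2 * r * r' - (2 * ρ - 1))) * (y ^ 2 * z) := mul_nonneg c8 (by positivity)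
  have m9 : 0 ≤ ((2 * ρ - 1) * p * r + q * (2 * r * r' - (2 * ρ - 1))) * (y * z ^ 2) := mul_nonneg c9 (by positivity)
  have m10 : 0 ≤ ((2 * ρ - 1) * (1 / 2 + p * p' + q * q' + r * r') + 2 * (p * r * q' + q * p' * r') - 1) * (x * y * z) :=
    mul_nonneg c10 (by positivity)
  linarith


/-- **THE PROFILE SUM OF THREE AGES IS AT MOST TWO** once the ten coefficients of §1's cubic are non-negative and the three rider-free denominators
`D_a, D_b, D_c` are positive: `x∕D_a + y∕D_b + z∕D_c ≤ 2`. [folklore] -/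
theorem three_age_sum_div_le_two {ρ p p' q q' r r' x y z : ℝ} (hρ : ρ * ρ = 1 / 2) (hx : 0 ≤ x) (hy : 0 ≤ y) (hz : 0 ≤ z)
    (c1 : 0 ≤ (2 * ρ - 1) * p' * q') (c2 : 0 ≤ (2 * ρ - 1) * p * r') (c3 : 0 ≤ (2 * ρ - 1) * q * r)
    (c4 : 0 ≤ (2 * ρ - 1) * p' * r' + q' * (2 * p * p' - (2 * ρ - 1)))
    (c5 : 0 ≤ (2 * ρ - 1) * r * q' + p' * (2 * q * q' - (2 * ρ - 1)))
    (c6 : 0 ≤ (2 * ρ - 1) * p * q' + r' * (2 * p * p' - (2 * ρ - 1)))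
    (c7 : 0 ≤ (2 * ρ - 1) * q * p' + r * (2 * q * q' - (2 * ρ - 1)))
    (c8 : 0 ≤ (2 * ρ - 1) * q * r' + p * (2 * r * r' - (2 * ρ - 1)))
    (c9 : 0 ≤ (2 * ρ - 1) * p * r + q * (2 * r * r' - (2 * ρ - 1)))
    (c10 : 0 ≤ (2 * ρ - 1) * (1 / 2 + p * p' + q * q' + r * r') + 2 * (p * r * q' + q * p' * r') - 1)
    (hDa : 0 < ρ * x + p * y + q * z) (hDb : 0 < p' * x + ρ * y + r * z) (hDc : 0 < q' * x + r' * y + ρ * z) :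
    x / (ρ * x + p * y + q * z) + y / (p' * x + ρ * y + r * z) + z / (q' * x + r' * y + ρ * z) ≤ 2 := by
  have hform := three_age_form_le hρ hx hy hz c1 c2 c3 c4 c5 c6 c7 c8 c9 c10
  rw [div_add_div _ _ hDa.ne' hDb.ne', div_add_div _ _ (mul_pos hDa hDb).ne' hDc.ne', div_le_iff₀ (by positivity)]
  linarith [hform]

/-- A linear form with coefficients `≥ m > 0` is positive at a non-zero point of the orthant. [folklore] -/
theorem pos_of_coeff_ge {m a₁ a₂ a₃ x y z : ℝ} (hm : 0 < m) (h₁ : m ≤ a₁) (h₂ : m ≤ a₂) (h₃ : m ≤ a₃) (hx : 0 ≤ x) (hy : 0 ≤ y) (hz : 0 ≤ z)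
    (hpos : 0 < x + y + z) : 0 < a₁ * x + a₂ * y + a₃ * z := by
  have e₁ : m * x ≤ a₁ * x := mul_le_mul_of_nonneg_right h₁ hx
  have e₂ : m * y ≤ a₂ * y := mul_le_mul_of_nonneg_right h₂ hy
  have e₃ : m * z ≤ a₃ * z := mul_le_mul_of_nonneg_right h₃ hz
  nlinarith

/-- The diagonal read `ρ = √½`: `ρ·ρ = ½` and `1.4142 ≤ 2ρ < 1.4143`. [folklore] -/
theorem sqrt_half_bounds : Real.sqrt (1 / 2) * Real.sqrt (1 / 2) = 1 / 2 ∧ 1.4142 ≤ 2 * Real.sqrt (1 / 2) ∧ 2 * Real.sqrt (1 / 2) < 1.4143 := by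
  have h0 : 0 < Real.sqrt (1 / 2) := Real.sqrt_pos.mpr (by norm_num)
  have hsq : Real.sqrt (1 / 2) * Real.sqrt (1 / 2) = 1 / 2 := Real.mul_self_sqrt (by norm_num)
  refine ⟨hsq, ?_, ?_⟩ <;> nlinarith

/-! ## §2 The reads of three ages `1 ≤ k₁ ≤ k₂ ≤ k₃ ≤ 36·k₁` -/

/-- The pair product of the two reads of two ages: `√(m∕(m+n))·√(n∕(n+m)) = √m·√n ∕ (m+n)` (`m ≥ 1`). [folklore] -/
theorem sqrt_pair_mul {m n : ℕ} (hm : 1 ≤ m) :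
    Real.sqrt ((m : ℝ) / ((m : ℝ) + n)) * Real.sqrt ((n : ℝ) / ((n : ℝ) + m)) = Real.sqrt m * Real.sqrt n / ((m : ℝ) + n) := by
  have hmr : (0 : ℝ) < m := by exact_mod_cast hm
  have hnr : (0 : ℝ) ≤ n := Nat.cast_nonneg n
  have hS : (0 : ℝ) < (m : ℝ) + n := by linarith
  have hS' : (n : ℝ) + m ≠ 0 := by rw [add_comm]; exact hS.ne'
  have hL : 0 ≤ Real.sqrt ((m : ℝ) / ((m : ℝ) + n)) * Real.sqrt ((n : ℝ) / ((n : ℝ) + m)) := by positivity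
  have hR : 0 ≤ Real.sqrt m * Real.sqrt n / ((m : ℝ) + n) := by positivity
  rw [← Real.sqrt_sq hL, ← Real.sqrt_sq hR, mul_pow, div_pow, mul_pow, Real.sq_sqrt (div_nonneg hmr.le hS.le),
    Real.sq_sqrt (div_nonneg hnr (by linarith)), Real.sq_sqrt hmr.le, Real.sq_sqrt hnr]
  congr 1
  field_simp
  ring

/-- **`r ≥ 2ρ·q·p′`**: `2·√½·√(k₁∕(k₁+k₃))·√(k₂∕(k₂+k₁)) ≤ √(k₂∕(k₂+k₃))` for `1 ≤ k₁ ≤ k₂`, `k₁ ≤ k₃` — squared, `2k₁k₂(k₂+k₃) ≤ k₂(k₁+k₃)(k₂+k₁)` ⟸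
`k₂(k₂−k₁)(k₃−k₁) ≥ 0`. [folklore] -/
theorem read23_ge (hk₁ : 1 ≤ k₁) (h12 : k₁ ≤ k₂) (h13 : k₁ ≤ k₃) :
    2 * Real.sqrt (1 / 2) * Real.sqrt ((k₁ : ℝ) / ((k₁ : ℝ) + k₃)) * Real.sqrt ((k₂ : ℝ) / ((k₂ : ℝ) + k₁))
      ≤ Real.sqrt ((k₂ : ℝ) / ((k₂ : ℝ) + k₃)) := by
  have hk₁r : (1 : ℝ) ≤ k₁ := by exact_mod_cast hk₁
  have h12r : (k₁ : ℝ) ≤ k₂ := by exact_mod_cast h12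
  have h13r : (k₁ : ℝ) ≤ k₃ := by exact_mod_cast h13
  have hA : (0 : ℝ) < (k₁ : ℝ) + k₃ := by linarith
  have hB : (0 : ℝ) < (k₂ : ℝ) + k₁ := by linarith
  have hC : (0 : ℝ) < (k₂ : ℝ) + k₃ := by linarith
  refine Real.le_sqrt_of_sq_le ?_
  have e : (2 * Real.sqrt (1 / 2) * Real.sqrt ((k₁ : ℝ) / ((k₁ : ℝ) + k₃)) * Real.sqrt ((k₂ : ℝ) / ((k₂ : ℝ) + k₁))) ^ 2
      = 2 * k₁ * k₂ / (((k₁ : ℝ) + k₃) * ((k₂ : ℝ) + k₁)) := by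
    rw [mul_pow, mul_pow, mul_pow, Real.sq_sqrt (by norm_num : (0 : ℝ) ≤ 1 / 2), Real.sq_sqrt (div_nonneg (by linarith) hA.le),
      Real.sq_sqrt (div_nonneg (by linarith) hB.le)]
    field_simp
  rw [e, div_le_div_iff₀ (mul_pos hA hB) hC]
  have hid : (k₂ : ℝ) * (((k₁ : ℝ) + k₃) * ((k₂ : ℝ) + k₁)) - 2 * k₁ * k₂ * ((k₂ : ℝ) + k₃) = k₂ * ((k₂ - k₁) * (k₃ - k₁)) := by ring
  nlinarith [hid, mul_nonneg (by linarith : (0 : ℝ) ≤ k₂) (mul_nonneg (sub_nonneg.mpr h12r) (sub_nonneg.mpr h13r))]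

/-- **`p′ ≥ 2ρ·q′·r`**: `2·√½·√(k₃∕(k₃+k₁))·√(k₂∕(k₂+k₃)) ≤ √(k₂∕(k₂+k₁))` for `1 ≤ k₁ ≤ k₃`, `k₂ ≤ k₃` — squared, `2k₃k₂(k₂+k₁) ≤ k₂(k₃+k₁)(k₂+k₃)` ⟸
`k₂(k₃−k₁)(k₃−k₂) ≥ 0`. [folklore] -/
theorem read21_ge (hk₁ : 1 ≤ k₁) (h13 : k₁ ≤ k₃) (h23 : k₂ ≤ k₃) :
    2 * Real.sqrt (1 / 2) * Real.sqrt ((k₃ : ℝ) / ((k₃ : ℝ) + k₁)) * Real.sqrt ((k₂ : ℝ) / ((k₂ : ℝ) + k₃))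
      ≤ Real.sqrt ((k₂ : ℝ) / ((k₂ : ℝ) + k₁)) := by
  have hk₁r : (1 : ℝ) ≤ k₁ := by exact_mod_cast hk₁
  have h13r : (k₁ : ℝ) ≤ k₃ := by exact_mod_cast h13
  have h23r : (k₂ : ℝ) ≤ k₃ := by exact_mod_cast h23
  have hk₂r : (0 : ℝ) ≤ k₂ := Nat.cast_nonneg k₂
  have hA : (0 : ℝ) < (k₃ : ℝ) + k₁ := by linarith
  have hB : (0 : ℝ) < (k₂ : ℝ) + k₃ := by linarith
  have hC : (0 : ℝ) < (k₂ : ℝ) + k₁ := by linarith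
  refine Real.le_sqrt_of_sq_le ?_
  have e : (2 * Real.sqrt (1 / 2) * Real.sqrt ((k₃ : ℝ) / ((k₃ : ℝ) + k₁)) * Real.sqrt ((k₂ : ℝ) / ((k₂ : ℝ) + k₃))) ^ 2
      = 2 * k₃ * k₂ / (((k₃ : ℝ) + k₁) * ((k₂ : ℝ) + k₃)) := by
    rw [mul_pow, mul_pow, mul_pow, Real.sq_sqrt (by norm_num : (0 : ℝ) ≤ 1 / 2), Real.sq_sqrt (div_nonneg (by linarith) hA.le),
      Real.sq_sqrt (div_nonneg hk₂r hB.le)]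
    field_simp
  rw [e, div_le_div_iff₀ (mul_pos hA hB) hC]
  have hid : (k₂ : ℝ) * (((k₃ : ℝ) + k₁) * ((k₂ : ℝ) + k₃)) - 2 * k₃ * k₂ * ((k₂ : ℝ) + k₁) = k₂ * ((k₃ - k₁) * (k₃ - k₂)) := by ring
  nlinarith [hid, mul_nonneg hk₂r (mul_nonneg (sub_nonneg.mpr h13r) (sub_nonneg.mpr h23r))]

/-- **`pr ≥ ρq`**: `√½·√(k₁∕(k₁+k₃)) ≤ √(k₁∕(k₁+k₂))·√(k₂∕(k₂+k₃))` for `1 ≤ k₁ ≤ k₂ ≤ k₃` — squared, `k₁(k₁+k₂)(k₂+k₃) ≤ 2k₁k₂(k₁+k₃)` ⟸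
`k₁(k₂−k₁)(k₃−k₂) ≥ 0`. [folklore] -/
theorem read12_mul_read23_ge (hk₁ : 1 ≤ k₁) (h12 : k₁ ≤ k₂) (h23 : k₂ ≤ k₃) :
    Real.sqrt (1 / 2) * Real.sqrt ((k₁ : ℝ) / ((k₁ : ℝ) + k₃))
      ≤ Real.sqrt ((k₁ : ℝ) / ((k₁ : ℝ) + k₂)) * Real.sqrt ((k₂ : ℝ) / ((k₂ : ℝ) + k₃)) := by
  have hk₁r : (1 : ℝ) ≤ k₁ := by exact_mod_cast hk₁
  have h12r : (k₁ : ℝ) ≤ k₂ := by exact_mod_cast h12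
  have h23r : (k₂ : ℝ) ≤ k₃ := by exact_mod_cast h23
  have hA : (0 : ℝ) < (k₁ : ℝ) + k₃ := by linarith
  have hB : (0 : ℝ) < (k₁ : ℝ) + k₂ := by linarith
  have hC : (0 : ℝ) < (k₂ : ℝ) + k₃ := by linarith
  rw [← Real.sqrt_mul (div_nonneg (by linarith) hB.le)]
  refine Real.le_sqrt_of_sq_le ?_
  have e : (Real.sqrt (1 / 2) * Real.sqrt ((k₁ : ℝ) / ((k₁ : ℝ) + k₃))) ^ 2 = k₁ / (2 * ((k₁ : ℝ) + k₃)) := by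
    rw [mul_pow, Real.sq_sqrt (by norm_num : (0 : ℝ) ≤ 1 / 2), Real.sq_sqrt (div_nonneg (by linarith) hA.le)]
    field_simp
  rw [e, div_mul_div_comm, div_le_div_iff₀ (by positivity) (mul_pos hB hC)]
  have hid : (k₁ : ℝ) * k₂ * (2 * ((k₁ : ℝ) + k₃)) - k₁ * (((k₁ : ℝ) + k₂) * ((k₂ : ℝ) + k₃)) = k₁ * ((k₂ - k₁) * (k₃ - k₂)) := by ring
  nlinarith [hid, mul_nonneg (by linarith : (0 : ℝ) ≤ k₁) (mul_nonneg (sub_nonneg.mpr h12r) (sub_nonneg.mpr h23r))]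

/-- **`p′r′ ≥ ρq′`**: `√½·√(k₃∕(k₃+k₁)) ≤ √(k₂∕(k₂+k₁))·√(k₃∕(k₃+k₂))` for `1 ≤ k₁ ≤ k₂ ≤ k₃` — squared, `k₃(k₂+k₁)(k₃+k₂) ≤ 2k₂k₃(k₃+k₁)` ⟸
`k₃(k₂−k₁)(k₃−k₂) ≥ 0`. [folklore] -/
theorem read21_mul_read32_ge (hk₁ : 1 ≤ k₁) (h12 : k₁ ≤ k₂) (h23 : k₂ ≤ k₃) :
    Real.sqrt (1 / 2) * Real.sqrt ((k₃ : ℝ) / ((k₃ : ℝ) + k₁))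
      ≤ Real.sqrt ((k₂ : ℝ) / ((k₂ : ℝ) + k₁)) * Real.sqrt ((k₃ : ℝ) / ((k₃ : ℝ) + k₂)) := by
  have hk₁r : (1 : ℝ) ≤ k₁ := by exact_mod_cast hk₁
  have h12r : (k₁ : ℝ) ≤ k₂ := by exact_mod_cast h12
  have h23r : (k₂ : ℝ) ≤ k₃ := by exact_mod_cast h23
  have hA : (0 : ℝ) < (k₃ : ℝ) + k₁ := by linarith
  have hB : (0 : ℝ) < (k₂ : ℝ) + k₁ := by linarith
  have hC : (0 : ℝ) < (k₃ : ℝ) + k₂ := by linarith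
  rw [← Real.sqrt_mul (div_nonneg (by linarith) hB.le)]
  refine Real.le_sqrt_of_sq_le ?_
  have e : (Real.sqrt (1 / 2) * Real.sqrt ((k₃ : ℝ) / ((k₃ : ℝ) + k₁))) ^ 2 = k₃ / (2 * ((k₃ : ℝ) + k₁)) := by
    rw [mul_pow, Real.sq_sqrt (by norm_num : (0 : ℝ) ≤ 1 / 2), Real.sq_sqrt (div_nonneg (by linarith) hA.le)]
    field_simp
  rw [e, div_mul_div_comm, div_le_div_iff₀ (by positivity) (mul_pos hB hC)]
  have hid : (k₂ : ℝ) * k₃ * (2 * ((k₃ : ℝ) + k₁)) - k₃ * (((k₂ : ℝ) + k₁) * ((k₃ : ℝ) + k₂)) = k₃ * ((k₂ - k₁) * (k₃ - k₂)) := by ring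
  nlinarith [hid, mul_nonneg (by linarith : (0 : ℝ) ≤ k₃) (mul_nonneg (sub_nonneg.mpr h12r) (sub_nonneg.mpr h23r))]

/-- **`qr′ ≥ 0.2293·p`**: `0.2293·√(k₁∕(k₁+k₂)) ≤ √(k₁∕(k₁+k₃))·√(k₃∕(k₃+k₂))` for `1 ≤ k₁ ≤ k₂ ≤ k₃ ≤ 36k₁` — squared, `0.2293²·k₁(k₁+k₃)(k₃+k₂) ≤
k₁k₃(k₁+k₂)` ⟸ `36·[1369k₃(k₁+k₂) − 72(k₁+k₃)(k₂+k₃)] = 36k₁·0 + (36k₁−k₃)(1297k₃−72k₂) + 1295k₃(36k₂−k₃) ≥ 0` and `1369·0.2293² ≤ 72`. [folklore] -/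
theorem read13_mul_read32_ge (hk₁ : 1 ≤ k₁) (h12 : k₁ ≤ k₂) (h23 : k₂ ≤ k₃) (h31 : k₃ ≤ 36 * k₁) :
    0.2293 * Real.sqrt ((k₁ : ℝ) / ((k₁ : ℝ) + k₂))
      ≤ Real.sqrt ((k₁ : ℝ) / ((k₁ : ℝ) + k₃)) * Real.sqrt ((k₃ : ℝ) / ((k₃ : ℝ) + k₂)) := by
  have hk₁r : (1 : ℝ) ≤ k₁ := by exact_mod_cast hk₁
  have h12r : (k₁ : ℝ) ≤ k₂ := by exact_mod_cast h12
  have h23r : (k₂ : ℝ) ≤ k₃ := by exact_mod_cast h23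
  have h31r : (k₃ : ℝ) ≤ 36 * k₁ := by exact_mod_cast h31
  have hA : (0 : ℝ) < (k₁ : ℝ) + k₂ := by linarith
  have hB : (0 : ℝ) < (k₁ : ℝ) + k₃ := by linarith
  have hC : (0 : ℝ) < (k₃ : ℝ) + k₂ := by linarith
  rw [← Real.sqrt_mul (div_nonneg (by linarith) hB.le)]
  refine Real.le_sqrt_of_sq_le ?_
  have e : (0.2293 * Real.sqrt ((k₁ : ℝ) / ((k₁ : ℝ) + k₂))) ^ 2 = 0.2293 ^ 2 * k₁ / ((k₁ : ℝ) + k₂) := by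
    rw [mul_pow, Real.sq_sqrt (div_nonneg (by linarith) hA.le), mul_div_assoc]
  rw [e, div_mul_div_comm, div_le_div_iff₀ hA (mul_pos hB hC)]
  have hid : (36 : ℝ) * (1369 * k₃ * (k₁ + k₂) - 72 * ((k₁ + k₃) * (k₃ + k₂)))
      = (36 * k₁ - k₃) * (1297 * k₃ - 72 * k₂) + 1295 * k₃ * (36 * k₂ - k₃) := by ring
  have h1 : (0 : ℝ) ≤ (36 * k₁ - k₃) * (1297 * k₃ - 72 * k₂) := mul_nonneg (by linarith) (by linarith)
  have h2 : (0 : ℝ) ≤ 1295 * k₃ * (36 * k₂ - k₃) := mul_nonneg (by linarith) (by linarith)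
  have h3 : (0 : ℝ) ≤ 1369 * k₃ * (k₁ + k₂) - 72 * ((k₁ + k₃) * (k₃ + k₂)) := by nlinarith [hid, h1, h2]
  nlinarith [mul_nonneg (by linarith : (0 : ℝ) ≤ k₁) h3, mul_nonneg (by linarith : (0 : ℝ) ≤ k₁) (mul_nonneg hB.le hC.le)]

/-- **`pq′ ≥ 0.2293·r′`**: `0.2293·√(k₃∕(k₃+k₂)) ≤ √(k₁∕(k₁+k₂))·√(k₃∕(k₃+k₁))` for `1 ≤ k₁ ≤ k₂ ≤ k₃ ≤ 36k₁` — squared, `0.2293²·k₃(k₁+k₂)(k₃+k₁) ≤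
k₁k₃(k₃+k₂)` ⟸ `1369k₁(k₃+k₂) − 72(k₁+k₂)(k₃+k₁) = (36k₁−k₃)(72k₂−2k₁) + 1295k₁(k₃−k₂) ≥ 0`. [folklore] -/
theorem read12_mul_read31_ge (hk₁ : 1 ≤ k₁) (h12 : k₁ ≤ k₂) (h23 : k₂ ≤ k₃) (h31 : k₃ ≤ 36 * k₁) :
    0.2293 * Real.sqrt ((k₃ : ℝ) / ((k₃ : ℝ) + k₂))
      ≤ Real.sqrt ((k₁ : ℝ) / ((k₁ : ℝ) + k₂)) * Real.sqrt ((k₃ : ℝ) / ((k₃ : ℝ) + k₁)) := by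
  have hk₁r : (1 : ℝ) ≤ k₁ := by exact_mod_cast hk₁
  have h12r : (k₁ : ℝ) ≤ k₂ := by exact_mod_cast h12
  have h23r : (k₂ : ℝ) ≤ k₃ := by exact_mod_cast h23
  have h31r : (k₃ : ℝ) ≤ 36 * k₁ := by exact_mod_cast h31
  have hA : (0 : ℝ) < (k₃ : ℝ) + k₂ := by linarith
  have hB : (0 : ℝ) < (k₁ : ℝ) + k₂ := by linarith
  have hC : (0 : ℝ) < (k₃ : ℝ) + k₁ := by linarith
  rw [← Real.sqrt_mul (div_nonneg (by linarith) hB.le)]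
  refine Real.le_sqrt_of_sq_le ?_
  have e : (0.2293 * Real.sqrt ((k₃ : ℝ) / ((k₃ : ℝ) + k₂))) ^ 2 = 0.2293 ^ 2 * k₃ / ((k₃ : ℝ) + k₂) := by
    rw [mul_pow, Real.sq_sqrt (div_nonneg (by linarith) hA.le), mul_div_assoc]
  rw [e, div_mul_div_comm, div_le_div_iff₀ hA (mul_pos hB hC)]
  have hid : (1369 : ℝ) * k₁ * (k₃ + k₂) - 72 * ((k₁ + k₂) * (k₃ + k₁)) = (36 * k₁ - k₃) * (72 * k₂ - 2 * k₁) + 1295 * k₁ * (k₃ - k₂) := by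
    ring
  have h1 : (0 : ℝ) ≤ (36 * k₁ - k₃) * (72 * k₂ - 2 * k₁) := mul_nonneg (by linarith) (by linarith)
  have h2 : (0 : ℝ) ≤ 1295 * k₁ * (k₃ - k₂) := mul_nonneg (by linarith) (by linarith)
  have h3 : (0 : ℝ) ≤ 1369 * k₁ * (k₃ + k₂) - 72 * ((k₁ + k₂) * (k₃ + k₁)) := by linarith [hid, h1, h2]
  nlinarith [mul_nonneg (by linarith : (0 : ℝ) ≤ k₃) h3, mul_nonneg (by linarith : (0 : ℝ) ≤ k₃) (mul_nonneg hB.le hC.le)]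

/-- A diagonal read is below every read of an older age: `√½ ≤ √(n∕(n+m))` for `m ≤ n`, `1 ≤ n`. [folklore] -/
theorem diag_le_read_of_le {m n : ℕ} (hn : 1 ≤ n) (hmn : m ≤ n) :
    Real.sqrt (1 / 2) ≤ Real.sqrt ((n : ℝ) / ((n : ℝ) + m)) := by
  have hnr : (1 : ℝ) ≤ n := by exact_mod_cast hn
  have hmnr : (m : ℝ) ≤ n := by exact_mod_cast hmn
  have hm0 : (0 : ℝ) ≤ m := Nat.cast_nonneg m
  refine Real.sqrt_le_sqrt ?_
  rw [div_le_div_iff₀ (by norm_num) (by linarith)]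
  linarith

/-- **THE PAIR-SUM LEMMA, polynomial form.**  For `0 < α ≤ β ≤ δ ≤ 6α`: `αβ∕(α²+β²) + βδ∕(β²+δ²) − αδ∕(α²+δ²) ≥ ½` — the cleared difference is
`½·(β−α)(δ−β)·K` with `K = δ²(β−α)(6α−δ) + δ²((β−5α∕2)² + 7α²∕4) + 2αβ²δ + α²βδ + α²β² + α³(δ−β) ≥ 0`. [folklore] -/
theorem pairSum_ge_half_aux {α β δ : ℝ} (hα : 0 < α) (hαβ : α ≤ β) (hβδ : β ≤ δ) (hδ : δ ≤ 6 * α) :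
    1 / 2 ≤ α * β / (α ^ 2 + β ^ 2) + β * δ / (β ^ 2 + δ ^ 2) - α * δ / (α ^ 2 + δ ^ 2) := by
  have hβ : 0 < β := lt_of_lt_of_le hα hαβ
  have hδ0 : 0 < δ := lt_of_lt_of_le hβ hβδ
  have h1 : 0 < α ^ 2 + β ^ 2 := by positivity
  have h2 : 0 < β ^ 2 + δ ^ 2 := by positivity
  have h3 : 0 < α ^ 2 + δ ^ 2 := by positivity
  have hK : 0 ≤ -β * δ ^ 3 + β ^ 2 * δ ^ 2 + α * δ ^ 3 + α * β * δ ^ 2 + 2 * α * β ^ 2 * δ + 2 * α ^ 2 * δ ^ 2 + α ^ 2 * β * δ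
      + α ^ 2 * β ^ 2 + α ^ 3 * δ - α ^ 3 * β := by
    have hKid : -β * δ ^ 3 + β ^ 2 * δ ^ 2 + α * δ ^ 3 + α * β * δ ^ 2 + 2 * α * β ^ 2 * δ + 2 * α ^ 2 * δ ^ 2 + α ^ 2 * β * δ
        + α ^ 2 * β ^ 2 + α ^ 3 * δ - α ^ 3 * β
        = δ ^ 2 * (β - α) * (6 * α - δ) + δ ^ 2 * ((β - 5 / 2 * α) ^ 2 + 7 / 4 * α ^ 2) + (2 * α * β ^ 2 * δ + α ^ 2 * β * δ + α ^ 2 * β ^ 2)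
          + α ^ 3 * (δ - β) := by ring
    rw [hKid]
    have t1 : 0 ≤ δ ^ 2 * (β - α) * (6 * α - δ) := mul_nonneg (mul_nonneg (sq_nonneg δ) (by linarith)) (by linarith)
    have t2 : 0 ≤ δ ^ 2 * ((β - 5 / 2 * α) ^ 2 + 7 / 4 * α ^ 2) := by positivity
    have t3 : 0 ≤ 2 * α * β ^ 2 * δ + α ^ 2 * β * δ + α ^ 2 * β ^ 2 := by positivity
    have t4 : 0 ≤ α ^ 3 * (δ - β) := mul_nonneg (pow_nonneg hα.le 3) (by linarith)
    linarith
  have hH : 0 ≤ (β - α) * (δ - β) * (-β * δ ^ 3 + β ^ 2 * δ ^ 2 + α * δ ^ 3 + α * β * δ ^ 2 + 2 * α * β ^ 2 * δ + 2 * α ^ 2 * δ ^ 2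
      + α ^ 2 * β * δ + α ^ 2 * β ^ 2 + α ^ 3 * δ - α ^ 3 * β) := mul_nonneg (mul_nonneg (by linarith) (by linarith)) hK
  rw [div_add_div _ _ h1.ne' h2.ne', div_sub_div _ _ (mul_pos h1 h2).ne' h3.ne', le_div_iff₀ (by positivity)]
  have hid : (α * β * (β ^ 2 + δ ^ 2) + (α ^ 2 + β ^ 2) * (β * δ)) * (α ^ 2 + δ ^ 2) - (α ^ 2 + β ^ 2) * (β ^ 2 + δ ^ 2) * (α * δ)
      - 1 / 2 * ((α ^ 2 + β ^ 2) * (β ^ 2 + δ ^ 2) * (α ^ 2 + δ ^ 2))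
      = 1 / 2 * ((β - α) * (δ - β) * (-β * δ ^ 3 + β ^ 2 * δ ^ 2 + α * δ ^ 3 + α * β * δ ^ 2 + 2 * α * β ^ 2 * δ + 2 * α ^ 2 * δ ^ 2
        + α ^ 2 * β * δ + α ^ 2 * β ^ 2 + α ^ 3 * δ - α ^ 3 * β)) := by ring
  nlinarith [hid, hH]

/-- **THE PAIR-SUM LEMMA**: `pp′ + rr′ − qq′ ≥ ½` for `1 ≤ k₁ ≤ k₂ ≤ k₃ ≤ 36·k₁` (`pp′ = √(k₁k₂)∕(k₁+k₂)` etc.; zero on the faces `k₁ = k₂`, `k₂ = k₃`;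
fails from outer ratio `≈ 70`). [folklore] -/
theorem pairSum_ge_half (hk₁ : 1 ≤ k₁) (h12 : k₁ ≤ k₂) (h23 : k₂ ≤ k₃) (h31 : k₃ ≤ 36 * k₁) :
    1 / 2 ≤ Real.sqrt ((k₁ : ℝ) / ((k₁ : ℝ) + k₂)) * Real.sqrt ((k₂ : ℝ) / ((k₂ : ℝ) + k₁))
      + Real.sqrt ((k₂ : ℝ) / ((k₂ : ℝ) + k₃)) * Real.sqrt ((k₃ : ℝ) / ((k₃ : ℝ) + k₂))
      - Real.sqrt ((k₁ : ℝ) / ((k₁ : ℝ) + k₃)) * Real.sqrt ((k₃ : ℝ) / ((k₃ : ℝ) + k₁)) := by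
  have hk₂ : 1 ≤ k₂ := hk₁.trans h12
  have hk₁r : (1 : ℝ) ≤ k₁ := by exact_mod_cast hk₁
  have h12r : (k₁ : ℝ) ≤ k₂ := by exact_mod_cast h12
  have h23r : (k₂ : ℝ) ≤ k₃ := by exact_mod_cast h23
  have h31r : (k₃ : ℝ) ≤ 36 * k₁ := by exact_mod_cast h31
  rw [sqrt_pair_mul hk₁, sqrt_pair_mul hk₂, sqrt_pair_mul hk₁]
  have hα : 0 < Real.sqrt (k₁ : ℝ) := Real.sqrt_pos.mpr (by linarith)
  have hαβ : Real.sqrt (k₁ : ℝ) ≤ Real.sqrt (k₂ : ℝ) := Real.sqrt_le_sqrt h12r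
  have hβδ : Real.sqrt (k₂ : ℝ) ≤ Real.sqrt (k₃ : ℝ) := Real.sqrt_le_sqrt h23r
  have hδ : Real.sqrt (k₃ : ℝ) ≤ 6 * Real.sqrt (k₁ : ℝ) := by
    calc Real.sqrt (k₃ : ℝ) ≤ Real.sqrt ((6 * Real.sqrt (k₁ : ℝ)) ^ 2) :=
          Real.sqrt_le_sqrt (by rw [mul_pow, Real.sq_sqrt (by linarith)]; linarith)
      _ = 6 * Real.sqrt (k₁ : ℝ) := Real.sqrt_sq (by positivity)
  have key := pairSum_ge_half_aux hα hαβ hβδ hδ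
  rw [Real.sq_sqrt (by linarith : (0 : ℝ) ≤ k₁), Real.sq_sqrt (by linarith : (0 : ℝ) ≤ k₂),
    Real.sq_sqrt (by linarith : (0 : ℝ) ≤ k₃)] at key
  exact key

end Summit.QuantumFields.BalabanUV.Beta.EriceRemainderEnclosureHistoryAutonomyComparisonThreeAgesReads

end
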